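import Summits.MatrixMultiplication.MatrixMultiplication.Theses.StabilizerTensorRank

/-!
# MatrixMultiplication / StabilizerTensorRank — the assembly `Assembly` (stmt-MatrixMultiplication-10582)

Route `MatrixMultiplication/StabilizerTensorRank`, item stmt-MatrixMultiplication-10582 (`Assembly`,
rank 1):

  `OmegaStabTwo → MatrixMultiplication`.

Proof (pure glue, self-contained; it is also, verbatim, the type of the route's kernel-checked
deciding theorem `Summit.MatrixMultiplication.MatrixMultiplication.Theses.StabilizerTensorRank.closes`).
Given `ε > 0`, `OmegaStabTwo` yields `k ≥ 1`, `r ≤ 2^((2+ε)k)` and a stabilizer scheme of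
`⟨2^k, 2^k, 2^k⟩` with `r` terms; a stabilizer scheme is in particular a rank decomposition
(`HasStabilizerScheme`, `tensorRank_le_stabTensorRank`, `stabTensorRank_le_of_hasStabilizerScheme`),
so `R(⟨2^k⟩) ≤ r`; the flattening bound `(2^k)² ≤ R(⟨2^k⟩)` (`matMulTensor_sq_le_tensorRank`) forces
`r ≥ 1`; Bläser 2013 Thm 5.9 in interpolation form (`Blaser2013_logb_mem_admissibleExponents`) makes
`log_(2^k) r` an admissible exponent, hence `ω(ℂ) ≤ log_(2^k) r ≤ 2 + ε`; `ε → 0` and `omega_two_le`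
give `ω(ℂ) = 2`, which is `MatrixMultiplication` (`MatrixMultiplication_iff`).

References: M. Bläser, *Fast Matrix Multiplication*, Theory of Computing Graduate Surveys 5 (2013),
Thm 5.9; P. Bürgisser, M. Clausen, M. A. Shokrollahi, *Algebraic Complexity Theory* (1997),
Prop. 15.5.
-/

-- single-conjunct summit: the mandated namespace repeats `MatrixMultiplication` (summit = sub-problem).
set_option linter.dupNamespace false

namespace Summit.MatrixMultiplication.MatrixMultiplication.Theorems

open Summit.MatrixMultiplication.MatrixMultiplication.Theses.StabilizerTensorRank
open Literature.Computability.AlgebraicComplexity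

/-- The glue inequality of route StabilizerTensorRank: a stabilizer scheme of `⟨2^k, 2^k, 2^k⟩`
(`k ≥ 1`) with `r ≤ 2^((2+ε)k)` terms gives `ω(ℂ) ≤ 2 + ε` — rank ≤ stabilizer-scheme size,
Bläser 2013 Thm 5.9 (interpolation) `ω ≤ log_(2^k) r`, and `log_(2^k) r ≤ 2 + ε`.
[cite: Blaser2013, Thm 5.9] -/
theorem stabilizerTensorRank_omega_le_two_add {ε : ℝ} {k r : ℕ} (hk : 1 ≤ k)
    (hr : (r : ℝ) ≤ (2 : ℝ) ^ ((2 + ε) * k)) (hS : HasStabilizerScheme k r) :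
    omega ℂ ≤ 2 + ε := by
  -- the stabilizer scheme is in particular a rank decomposition: R(⟨2^k⟩) ≤ χ₃(⟨2^k⟩) ≤ r
  have hR : tensorRank (matMulTensor ℂ (2 ^ k) (2 ^ k) (2 ^ k)) ≤ r :=
    (tensorRank_le_stabTensorRank k).trans (stabTensorRank_le_of_hasStabilizerScheme hS)
  -- N = 2^k ≥ 2 and r ≥ 1 (flattening bound (2^k)² ≤ R(⟨2^k⟩) ≤ r)
  have hN : 1 < 2 ^ k :=
    lt_of_lt_of_le (by norm_num : 1 < 2 ^ 1) (Nat.pow_le_pow_right (by norm_num) hk)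
  have hsq := matMulTensor_sq_le_tensorRank ℂ (2 ^ k)
  have hpos : 0 < (2 ^ k) ^ 2 := by positivity
  have h0r : 0 < r := lt_of_lt_of_le hpos (hsq.trans hR)
  have hr1 : 1 ≤ r := Nat.succ_le_of_lt h0r
  -- Bläser 2013, Thm 5.9 (interpolation): log_{2^k} r is an admissible exponent, so ω ≤ log_{2^k} r
  have hmem := Blaser2013_logb_mem_admissibleExponents ℂ hN hr1 hR
  have hω : omega ℂ ≤ Real.logb ((2 ^ k : ℕ) : ℝ) r :=
    csInf_le (admissibleExponents_bddBelow ℂ) hmem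
  -- log_{2^k} r ≤ 2 + ε from r ≤ 2^((2+ε)k)
  have hkpos : (0 : ℝ) < k := Nat.cast_pos.mpr (by omega)
  have hlog2 : 0 < Real.log 2 := Real.log_pos one_lt_two
  have hr0 : (0 : ℝ) < r := Nat.cast_pos.mpr h0r
  have hbase : Real.log ((2 ^ k : ℕ) : ℝ) = k * Real.log 2 := by
    rw [Nat.cast_pow, Nat.cast_ofNat, Real.log_pow]
  have hlogr : Real.log (r : ℝ) ≤ (2 + ε) * k * Real.log 2 :=
    calc Real.log (r : ℝ) ≤ Real.log ((2 : ℝ) ^ ((2 + ε) * k)) := Real.log_le_log hr0 hr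
      _ = (2 + ε) * k * Real.log 2 := Real.log_rpow two_pos _
  have hlogb : Real.logb ((2 ^ k : ℕ) : ℝ) r ≤ 2 + ε := by
    rw [Real.logb, hbase, div_le_iff₀ (mul_pos hkpos hlog2)]
    calc Real.log (r : ℝ) ≤ (2 + ε) * k * Real.log 2 := hlogr
      _ = (2 + ε) * (k * Real.log 2) := by ring
  exact hω.trans hlogb

/-- **Assembly of route StabilizerTensorRank** (item stmt-MatrixMultiplication-10582):
`OmegaStabTwo → MatrixMultiplication`. For every `ε > 0` the target `OmegaStabTwo` (`ω_stab = 2`)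
supplies `k ≥ 1`, `r ≤ 2^((2+ε)k)` and an `r`-term stabilizer scheme of `⟨2^k, 2^k, 2^k⟩`, whence
`ω(ℂ) ≤ 2 + ε` (`stabilizerTensorRank_omega_le_two_add`); so `ω(ℂ) ≤ 2`, and `ω(ℂ) ≥ 2`
(`omega_two_le`, flattening bound) makes it `ω(ℂ) = 2`, which is `MatrixMultiplication`
(`MatrixMultiplication_iff`). The statement is literally the type of the route's deciding theorem
`Theses.StabilizerTensorRank.closes`; the proof here is self-contained.
[cite: Blaser2013, Thm 5.9] [cite: BurgisserClausenShokrollahi1997, Prop. 15.5] -/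
theorem stabilizerTensorRank_assembly_proof :
    Summit.MatrixMultiplication.MatrixMultiplication.Theses.StabilizerTensorRank.Assembly := by
  unfold Summit.MatrixMultiplication.MatrixMultiplication.Theses.StabilizerTensorRank.Assembly
  intro hT
  rw [_root_.MatrixMultiplication_iff]
  refine le_antisymm ?_ (omega_two_le ℂ)
  refine le_of_forall_pos_le_add fun ε hε => ?_
  obtain ⟨k, hk, r, hr, c, w, u, v, hleg, hsum⟩ := hT ε hε
  exact stabilizerTensorRank_omega_le_two_add hk hr ⟨c, w, u, v, hleg, hsum⟩

end Summit.MatrixMultiplication.MatrixMultiplication.Theorems
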